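import Summits.QuantumFields.BalabanUV.Beta.EriceRemainderEnclosureHolomorphySegment
import Mathlib.Analysis.Complex.Hadamard
import Mathlib.Analysis.Complex.ExponentialBounds
import Mathlib.Analysis.SpecialFunctions.Trigonometric.DerivHyp

/-!
# RemainderExplicitMarkovRate — ROAD P3: TWO CONSTANTS AT THE TIP OF A SLIT.  For g holomorphic on `ball 0 ρ` with ‖g‖ ≤ B, and
# ‖g‖ ≤ ε on the real SEGMENT [0, s₁]: ‖g′(0)‖ ≤ 25·ε^{1−r}·B^{r}∕(s₁r²) for EVERY r ∈ ]0, 1], hence ‖g′(0)‖ ≤ (25e²∕4s₁)·ε·max(log(B∕ε), 2)²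
# — Hadamard's three lines transported by the JOUKOWSKI chart w ↦ (s₁∕2)(1 + cosh w) (square-root harmonic measure at the tip), then Cauchy

Cell `pub-balaban`, β-function sub-cell, BINDER row D4 «RemainderConst leaves for Bałaban's split» (`HOME/BINDER-OWNERS.md`; owner
lineage `b2b-balaban-beta-an4`; this file by co-owner #3 lineage `b2b-balaban-beta-d4-p3`, road P3 «the reduction road», generation 35),
β-FLOW TEAM duty (1); FREEZE (0) honoured (def-free module in road P3's own `RemainderExplicit*` series; no leaf, no interface).

OCCASION.  Road P3's `RemainderExplicitClaimRate` (gen 34) proved that GIVEN ONLY the rate letter R «|β_n(s) − β(s)| ≤ c·θⁿ on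
[0, s₀]» and N2 the second coefficients β_{n,2} inherit the ratio √θ and no better (`sqrt_ratio_sharp`).  Co-owner #2's (E21)
`EriceRemainderEnclosureHolomorphyRate` then showed that ON THE ANALYTIC ROAD ((E18)'s triple: β_n the real traces of `F n` holomorphic
on the ρ-neighbourhood of the segment with ONE bound M) every ratio θ^{1−δ}, δ ∈ ]0, 1], is reached (constant e^{π²∕(4δ²)}; three lines
through the Gaussian chart w ↦ s₁·exp(w²)) and left OPEN «whether ratio θ itself (δ = 0, polynomial prefactor) holds … the
harmonic-measure question at the slit tip (expected n²θⁿ, Markov-type), NOT claimed» (journal INTENT S-d4p2-g25-1).  THIS FILE is the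
g-level engine that settles it (the companion `RemainderExplicitMarkovRateSharp` applies it on (E18)'s class; the exponent 2 is exact
by co-owner #2's (E22) Chebyshev witness): the only change w.r.t. (E21) §1–§2 is the chart.  `w ↦ (s₁∕2)(1 + cosh w)` maps the imaginary axis ONTO [0, s₁] (cosh(iy) = cos y),
the closed unit strip into the closed disc of radius s₁·cosh 1 (level lines = the confocal ellipses with foci 0, s₁ — Bernstein–Walsh),
has the TIP g² = 0 at w = iπ, and reaches every z with ‖z‖ = h ≤ s₁ from a w with |Re w| ≤ 5√(h∕s₁) (explicit inverse w = log(q + v),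
q = 2z∕s₁ − 1, v² = q² − 1, ‖q ± v‖ ≤ 1 + 5√(h∕s₁)): the SQUARE-ROOT law of harmonic measure at the end of a slit, against the Gaussian
chart's 1∕√(log(s₁∕h)).  Three lines give ‖g‖ ≤ ε^{1−5√(h∕s₁)}B^{5√(h∕s₁)} on that circle, Cauchy gives ‖g′(0)‖ ≤ 25ε^{1−r}B^{r}∕(s₁r²)
(h = s₁r²∕25), and r = 2∕log(B∕ε) gives the square of the logarithm — A. Markov's n² for a degree-n polynomial bounded by 1 on a
segment, with log(B∕ε) in the role of the degree.
presearch: two-constants theorem ∕ harmonic measure of a slit [corpus: hillend-analytic-function-theory II p. 340] (cited by (E21));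
Bernstein–Walsh on confocal ellipses, A. Markov's inequality — classical; no segment-tip estimate in the tree; the cosh chart is this file's.

HONEST FRAMING (BETA-SPEC §0.2, verbatim and binding). *"Discharging BetaPertH makes Bałaban's UV stability UNCONDITIONAL — a
real constructive-QFT result; it is NOT the continuum limit and NOT the Clay problem."*  This module discharges NOTHING of the kind:
folklore complex analysis (Hadamard three lines + Cauchy's estimate, Mathlib BY NAME) about ONE holomorphic function g; no β, no
Bałaban letter; nothing of Bałaban's (1.22) or of Bałaban–Jaffe's β_n is asserted, constructed or instantiated; row D4 class UNCHANGED
(critical-path width 0; instance 0∕1; D4 DISCHARGE NO DATE).  NOT B12 Thm 2, NOT BetaPertH, NOT continuum, NOT Clay.  HONEST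
DEPENDENCY: continuum YM on T⁴ ⇐ BetaPertH ∧ nine spine estimates (0/9 proved); BetaPertH ⇐ (D1) ∧ (D4) ∧ CAP+tail; G-an2-4 gates
asym, D1 and NE2/3/4.

WHAT IS PROVED ([folklore]; 0 sorry; 0 `def`).
* §1 THE JOUKOWSKI CHART: `norm_chart_le` (|Re w| ≤ 1 ⟹ ‖(s₁∕2)(1 + cosh w)‖ ≤ s₁·cosh 1),
  `chart_of_re_zero` (Re w = 0 ⟹ the value is the REAL number (s₁∕2)(1 + cos(Im w)) ∈ [0, s₁]), **`exists_chart_eq`** (‖z‖ = h ≤ s₁ ⟹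
  z = chart(w) with |Re w| ≤ 5√(h∕s₁)).
* §2 TWO CONSTANTS FROM A SEGMENT, ELLIPSE FORM (g holomorphic on `ball 0 ρ`, ‖g‖ ≤ B there, ‖g(s)‖ ≤ ε on [0, s₁], s₁·cosh 1 < ρ):
  **`norm_le_interp_of_segment`** (‖g(chart w)‖ ≤ ε^{1−Re w}·B^{Re w} on the closed unit strip), `norm_le_interp_of_segment_abs`.
* §3 AT THE TIP: **`norm_le_of_mem_sphere`** (0 < ε ≤ B, h ≤ s₁∕25: ‖g z‖ ≤ ε^{1−5√(h∕s₁)}·B^{5√(h∕s₁)} on ‖z‖ = h),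
  **`norm_deriv_le_of_segment`** (‖g′(0)‖ ≤ 25·ε^{1−r}·B^{r}∕(s₁r²), every r ∈ ]0, 1]), **`norm_deriv_le_log_sq`**
  (‖g′(0)‖ ≤ (25·e²∕(4s₁))·ε·max(log(B∕ε), 2)²), `cosh_one_lt_three` (so s₁ = ρ∕3 is admissible).
-/

noncomputable section

open Filter Topology Set Metric Complex
open Complex.HadamardThreeLines (verticalStrip verticalClosedStrip)

namespace Summit.QuantumFields.BalabanUV.Beta.RemainderExplicitMarkovRate

/-! ## §1 The Joukowski chart `w ↦ (s₁ ∕ 2) · (1 + cosh w)` -/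

/-- **The chart maps the closed unit strip into the closed disc of radius `s₁·cosh 1`**: for `|Re w| ≤ 1` and `0 ≤ s₁`,
`‖(s₁∕2)(1 + cosh w)‖ ≤ (s₁∕2)(1 + cosh(Re w)) ≤ s₁·cosh 1`. [folklore] -/
theorem norm_chart_le {s₁ : ℝ} (hs₁ : 0 ≤ s₁) {w : ℂ} (hw : |w.re| ≤ 1) :
    ‖(s₁ / 2 : ℂ) * (1 + Complex.cosh w)‖ ≤ s₁ * Real.cosh 1 := by
  -- `‖cosh w‖ ≤ cosh (Re w)` from `2 cosh w = e^w + e^{−w}` (the tree has it as the RH barrier file's `norm_ccosh_le_cosh_re`;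
  -- inlined here rather than importing an unrelated summit's barrier module)
  have h0 : ‖Complex.cosh w‖ ≤ Real.cosh w.re := by
    have h2 : (2 : ℝ) * ‖Complex.cosh w‖ = ‖Complex.exp w + Complex.exp (-w)‖ := by
      rw [← Complex.two_cosh, norm_mul]; norm_num
    have h3 : ‖Complex.exp w + Complex.exp (-w)‖ ≤ Real.exp w.re + Real.exp (-w.re) := by
      refine (norm_add_le _ _).trans (le_of_eq ?_)
      rw [Complex.norm_exp, Complex.norm_exp, Complex.neg_re]
    rw [Real.cosh_eq]
    linarith
  have h1 : ‖(1 : ℂ) + Complex.cosh w‖ ≤ 1 + Real.cosh w.re :=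
    (norm_add_le _ _).trans (by rw [norm_one]; exact add_le_add le_rfl h0)
  have h2 : Real.cosh w.re ≤ Real.cosh 1 := Real.cosh_le_cosh.mpr (by rwa [abs_one])
  have h3 : (1 : ℝ) ≤ Real.cosh 1 := Real.one_le_cosh 1
  have hn : ‖(s₁ / 2 : ℂ)‖ = s₁ / 2 := by
    rw [show (s₁ / 2 : ℂ) = ((s₁ / 2 : ℝ) : ℂ) by push_cast; ring, Complex.norm_real,
      Real.norm_of_nonneg (by positivity)]
  rw [norm_mul, hn]
  nlinarith [norm_nonneg ((1 : ℂ) + Complex.cosh w)]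

/-- **On the imaginary axis the chart is REAL and lands in `[0, s₁]`**: for `Re w = 0`,
`(s₁∕2)(1 + cosh w) = (s₁∕2)(1 + cos(Im w))`, a real number in `[0, s₁]` when `0 ≤ s₁`. [folklore] -/
theorem chart_of_re_zero {s₁ : ℝ} (hs₁ : 0 ≤ s₁) {w : ℂ} (hw : w.re = 0) :
    (s₁ / 2 : ℂ) * (1 + Complex.cosh w) = ((s₁ / 2 * (1 + Real.cos w.im) : ℝ) : ℂ) ∧
      0 ≤ s₁ / 2 * (1 + Real.cos w.im) ∧ s₁ / 2 * (1 + Real.cos w.im) ≤ s₁ := by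
  have hwI : w = (w.im : ℂ) * I := by
    apply Complex.ext <;> simp [hw]
  have hc : Complex.cosh w = (Real.cos w.im : ℂ) := by
    conv_lhs => rw [hwI]
    rw [Complex.cosh_mul_I, Complex.ofReal_cos]
  refine ⟨?_, ?_, ?_⟩
  · rw [hc]; push_cast; ring
  · have := Real.neg_one_le_cos w.im
    nlinarith
  · have := Real.cos_le_one w.im
    nlinarith

/-- **Every point of a small circle is a chart value with small real part — the square-root law at the tip.**  For `0 < s₁`,
`‖z‖ = h ≤ s₁` there is `w` with `(s₁∕2)(1 + cosh w) = z` and `|Re w| ≤ 5·√(h∕s₁)`: with `q = 2z∕s₁ − 1`, `v² = q² − 1`, `u = q + v`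
one has `u·(q − v) = 1`, `w := log u`, `cosh w = (u + u⁻¹)∕2 = q`; and ‖u‖, ‖u⁻¹‖ ≤ ‖q‖ + ‖v‖ ≤ (1 + 2h∕s₁) + 2√((h∕s₁)(1 + h∕s₁)) ≤ 1 + 5√(h∕s₁),
so `|Re w| = |log ‖u‖| ≤ log(1 + 5√(h∕s₁)) ≤ 5√(h∕s₁)`. [folklore] -/
theorem exists_chart_eq {s₁ h : ℝ} (hs₁ : 0 < s₁) (hhs : h ≤ s₁) {z : ℂ} (hz : ‖z‖ = h) :
    ∃ w : ℂ, (s₁ / 2 : ℂ) * (1 + Complex.cosh w) = z ∧ |w.re| ≤ 5 * Real.sqrt (h / s₁) := by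
  have hh0 : 0 ≤ h := hz ▸ norm_nonneg z
  set t : ℝ := h / s₁ with ht
  have ht0 : 0 ≤ t := div_nonneg hh0 hs₁.le
  have ht1 : t ≤ 1 := (div_le_one hs₁).mpr hhs
  set q : ℂ := 2 * z / s₁ - 1 with hq
  set v : ℂ := (q ^ 2 - 1) ^ ((2 : ℕ) : ℂ)⁻¹ with hv
  have hv2 : v ^ 2 = q ^ 2 - 1 := Complex.cpow_nat_inv_pow _ two_ne_zero
  set u : ℂ := q + v with hu
  have hu1 : u * (q - v) = 1 := by
    rw [hu]; linear_combination (-1 : ℂ) * hv2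
  have hu0 : u ≠ 0 := fun h0 => by rw [h0, zero_mul] at hu1; exact zero_ne_one hu1
  have huinv : u⁻¹ = q - v := inv_eq_of_mul_eq_one_right hu1
  -- norms
  have hs₁' : (s₁ : ℂ) ≠ 0 := Complex.ofReal_ne_zero.mpr hs₁.ne'
  have hzs : ‖2 * z / (s₁ : ℂ)‖ = 2 * t := by
    rw [norm_div, norm_mul, Complex.norm_real, Real.norm_of_nonneg hs₁.le, hz, ht]
    norm_num; ring
  have hqn : ‖q‖ ≤ 1 + 2 * t := by
    calc ‖q‖ = ‖2 * z / (s₁ : ℂ) - 1‖ := rfl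
      _ ≤ ‖2 * z / (s₁ : ℂ)‖ + ‖(1 : ℂ)‖ := norm_sub_le _ _
      _ = 1 + 2 * t := by rw [hzs, norm_one]; ring
  have hvn2 : ‖v‖ ^ 2 ≤ 9 * t := by
    have e1 : ‖v‖ ^ 2 = ‖q - 1‖ * ‖q + 1‖ := by
      rw [← norm_pow, hv2, show q ^ 2 - 1 = (q - 1) * (q + 1) by ring, norm_mul]
    have e2 : ‖q + 1‖ = 2 * t := by rw [hq, sub_add_cancel, hzs]
    have e3 : ‖q - 1‖ ≤ 2 * t + 2 := by
      calc ‖q - 1‖ = ‖2 * z / (s₁ : ℂ) - 2‖ := by rw [hq]; ring_nf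
        _ ≤ ‖2 * z / (s₁ : ℂ)‖ + ‖(2 : ℂ)‖ := norm_sub_le _ _
        _ = 2 * t + 2 := by rw [hzs]; norm_num
    rw [e1, e2]
    nlinarith [norm_nonneg (q - 1)]
  have hvn : ‖v‖ ≤ 3 * Real.sqrt t := by
    have h1 : ‖v‖ = Real.sqrt (‖v‖ ^ 2) := (Real.sqrt_sq (norm_nonneg v)).symm
    rw [h1, show 3 * Real.sqrt t = Real.sqrt (9 * t) by
      rw [show (9 : ℝ) * t = 3 ^ 2 * t by norm_num, Real.sqrt_mul (by norm_num), Real.sqrt_sq (by norm_num)]]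
    exact Real.sqrt_le_sqrt hvn2
  have htsq : t ≤ Real.sqrt t := by
    rw [Real.le_sqrt ht0 ht0]; nlinarith
  have hX : ‖q‖ + ‖v‖ ≤ 1 + 5 * Real.sqrt t := by linarith
  have hX0 : 0 < 1 + 5 * Real.sqrt t := by positivity
  have hun : ‖u‖ ≤ 1 + 5 * Real.sqrt t := (norm_add_le q v).trans hX
  have huin : ‖u‖⁻¹ ≤ 1 + 5 * Real.sqrt t := by
    rw [← norm_inv, huinv]; exact (norm_sub_le q v).trans hX
  have hupos : 0 < ‖u‖ := norm_pos_iff.mpr hu0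
  have hlog : Real.log (1 + 5 * Real.sqrt t) ≤ 5 * Real.sqrt t := by
    have := Real.log_le_sub_one_of_pos hX0; linarith
  refine ⟨Complex.log u, ?_, ?_⟩
  · -- cosh (log u) = (u + u⁻¹)/2 = q
    have hcosh : Complex.cosh (Complex.log u) = q := by
      have h2 := Complex.two_cosh (Complex.log u)
      rw [Complex.exp_neg, Complex.exp_log hu0, huinv, hu] at h2
      linear_combination (1 / 2 : ℂ) * h2
    rw [hcosh, hq]
    field_simp
    ring
  · rw [Complex.log_re]
    refine abs_le.mpr ⟨?_, ?_⟩
    · have h1 : Real.log ‖u‖⁻¹ ≤ 5 * Real.sqrt t :=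
        (Real.log_le_log (inv_pos.mpr hupos) huin).trans hlog
      rw [Real.log_inv] at h1
      linarith
    · exact (Real.log_le_log hupos hun).trans hlog

/-! ## §2 Two constants from a real segment — ellipse form -/

section TwoConstants

variable {g : ℂ → ℂ} {ρ s₁ ε B : ℝ}
  (hg : DifferentiableOn ℂ g (ball (0 : ℂ) ρ)) (hB : ∀ z ∈ ball (0 : ℂ) ρ, ‖g z‖ ≤ B)
  (hε : ∀ s : ℝ, 0 ≤ s → s ≤ s₁ → ‖g (s : ℂ)‖ ≤ ε)
include hg hB hε

/-- **TWO CONSTANTS FROM A SEGMENT (ellipse form).**  `g` holomorphic on `ball 0 ρ` with `‖g‖ ≤ B` there and `‖g(s)‖ ≤ ε` for real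
`s ∈ [0, s₁]`, `0 < s₁`, `s₁·cosh 1 < ρ`: for every `w` in the closed unit strip `0 ≤ Re w ≤ 1`,
`‖g ((s₁∕2)(1 + cosh w))‖ ≤ ε^{1 − Re w} · B^{Re w}` — Mathlib's three-lines theorem for `g ∘ chart`: the imaginary axis goes into the
segment (bound ε), the whole closed strip into the disc of radius `s₁·cosh 1` (bound B).  (The level line Re w = x is the ellipse with
foci 0, s₁ and sum of focal distances s₁·cosh x: Bernstein–Walsh.) [folklore] -/
theorem norm_le_interp_of_segment (hs₁ : 0 < s₁) (hs₁ρ : s₁ * Real.cosh 1 < ρ) {w : ℂ} (hw : w ∈ verticalClosedStrip 0 1) :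
    ‖g ((s₁ / 2 : ℂ) * (1 + Complex.cosh w))‖ ≤ ε ^ (1 - w.re) * B ^ w.re := by
  have hmaps : ∀ v ∈ verticalClosedStrip 0 1, (s₁ / 2 : ℂ) * (1 + Complex.cosh v) ∈ ball (0 : ℂ) ρ := by
    intro v hv
    have hv' : 0 ≤ v.re ∧ v.re ≤ 1 := hv
    rw [mem_ball, dist_zero_right]
    exact (norm_chart_le hs₁.le (abs_le.mpr ⟨by linarith [hv'.1], hv'.2⟩)).trans_lt hs₁ρ
  have hchart : Differentiable ℂ fun v : ℂ => (s₁ / 2 : ℂ) * (1 + Complex.cosh v) :=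
    (differentiable_const _).mul ((differentiable_const _).add Complex.differentiable_cosh)
  set Φ : ℂ → ℂ := fun v => g ((s₁ / 2 : ℂ) * (1 + Complex.cosh v)) with hΦ
  have hclosure : closure (verticalStrip 0 1) = verticalClosedStrip 0 1 := by
    rw [verticalStrip, verticalClosedStrip, Complex.closure_preimage_re, closure_Ioo zero_ne_one]
  have hsub : verticalStrip 0 1 ⊆ verticalClosedStrip 0 1 := fun v hv =>
    ⟨(show 0 < v.re ∧ v.re < 1 from hv).1.le, (show 0 < v.re ∧ v.re < 1 from hv).2.le⟩
  have hdiff : DifferentiableOn ℂ Φ (verticalStrip 0 1) := by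
    intro v hv
    exact ((hg.differentiableAt (isOpen_ball.mem_nhds (hmaps v (hsub hv)))).comp v (hchart v)).differentiableWithinAt
  have hcont : ContinuousOn Φ (closure (verticalStrip 0 1)) := by
    rw [hclosure]
    exact hg.continuousOn.comp hchart.continuous.continuousOn hmaps
  have hBdd : BddAbove ((norm ∘ Φ) '' verticalClosedStrip 0 1) := by
    refine ⟨B, ?_⟩; rintro _ ⟨v, hv, rfl⟩; exact hB _ (hmaps v hv)
  have ha : ∀ v ∈ Complex.re ⁻¹' ({0} : Set ℝ), ‖Φ v‖ ≤ ε := by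
    intro v hv
    have hv0 : v.re = 0 := hv
    obtain ⟨heq, hpos, hle⟩ := chart_of_re_zero hs₁.le hv0
    show ‖g ((s₁ / 2 : ℂ) * (1 + Complex.cosh v))‖ ≤ ε
    rw [heq]; exact hε _ hpos hle
  have hb : ∀ v ∈ Complex.re ⁻¹' ({1} : Set ℝ), ‖Φ v‖ ≤ B := by
    intro v hv
    have hv1 : v.re = 1 := hv
    exact hB _ (hmaps v ⟨by rw [hv1]; exact zero_le_one, by rw [hv1]⟩)
  exact Complex.HadamardThreeLines.norm_le_interp_of_mem_verticalClosedStrip₀₁' Φ hw ⟨hdiff, hcont⟩ hBdd ha hb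

/-- **The same for `|Re w| ≤ 1`** (cosh is even, so the left half of the double strip is reached by `w ↦ −w`):
`‖g ((s₁∕2)(1 + cosh w))‖ ≤ ε^{1 − |Re w|} · B^{|Re w|}`. [folklore] -/
theorem norm_le_interp_of_segment_abs (hs₁ : 0 < s₁) (hs₁ρ : s₁ * Real.cosh 1 < ρ) {w : ℂ} (hw : |w.re| ≤ 1) :
    ‖g ((s₁ / 2 : ℂ) * (1 + Complex.cosh w))‖ ≤ ε ^ (1 - |w.re|) * B ^ |w.re| := by
  rcases le_or_gt 0 w.re with h0 | h0
  · rw [abs_of_nonneg h0]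
    exact norm_le_interp_of_segment hg hB hε hs₁ hs₁ρ ⟨h0, (abs_of_nonneg h0) ▸ hw⟩
  · have hneg : Complex.cosh (-w) = Complex.cosh w := Complex.cosh_neg w
    have hre : (-w).re = |w.re| := by rw [Complex.neg_re, abs_of_neg h0]
    have := norm_le_interp_of_segment hg hB hε hs₁ hs₁ρ (w := -w) ⟨by rw [hre]; exact abs_nonneg _, by rw [hre]; exact hw⟩
    rwa [hneg, hre] at this

/-! ## §3 At the tip: small circles about g² = 0, Cauchy, and the choice of the radius -/

/-- **TWO CONSTANTS ON A SMALL CIRCLE ABOUT THE TIP.**  With `0 < ε ≤ B` and `0 < h ≤ s₁∕25`: on the circle `‖z‖ = h`,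
`‖g z‖ ≤ ε^{1 − 5√(h∕s₁)} · B^{5√(h∕s₁)}` — every point of that circle is a chart value with `|Re w| ≤ 5√(h∕s₁) ≤ 1` (`exists_chart_eq`),
and `y ↦ ε^{1−y} B^{y} = ε·(B∕ε)^{y}` is monotone. [folklore] -/
theorem norm_le_of_mem_sphere (hs₁ : 0 < s₁) (hs₁ρ : s₁ * Real.cosh 1 < ρ) (hε0 : 0 < ε) (hεB : ε ≤ B)
    {h : ℝ} (hh25 : h ≤ s₁ / 25) {z : ℂ} (hz : z ∈ sphere (0 : ℂ) h) :
    ‖g z‖ ≤ ε ^ (1 - 5 * Real.sqrt (h / s₁)) * B ^ (5 * Real.sqrt (h / s₁)) := by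
  have hhs : h ≤ s₁ := hh25.trans (by linarith)
  obtain ⟨w, hwz, hwre⟩ := exists_chart_eq hs₁ hhs (by simpa using hz : ‖z‖ = h)
  have hx1 : 5 * Real.sqrt (h / s₁) ≤ 1 := by
    have : Real.sqrt (h / s₁) ≤ 1 / 5 := by
      rw [show (1 / 5 : ℝ) = Real.sqrt ((1 / 5) ^ 2) by rw [Real.sqrt_sq (by norm_num)]]
      exact Real.sqrt_le_sqrt (by rw [div_le_iff₀ hs₁]; linarith)
    linarith
  have key := norm_le_interp_of_segment_abs hg hB hε hs₁ hs₁ρ (hwre.trans hx1)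
  rw [hwz] at key
  refine key.trans ?_
  have hB0 : 0 < B := hε0.trans_le hεB
  have hratio : 1 ≤ B / ε := (one_le_div hε0).mpr hεB
  have e1 : ∀ y : ℝ, ε ^ (1 - y) * B ^ y = ε * (B / ε) ^ y := by
    intro y
    rw [Real.rpow_sub hε0, Real.rpow_one, Real.div_rpow hB0.le hε0.le]
    field_simp
  rw [e1, e1]
  exact mul_le_mul_of_nonneg_left (Real.rpow_le_rpow_of_exponent_le hratio hwre) hε0.le

/-- **CAUCHY AFTER TWO CONSTANTS, EVERY RADIUS — the derivative at the tip of the segment**: for every `r ∈ ]0, 1]`,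
`‖g′(0)‖ ≤ 25 · ε^{1−r} · B^{r} ∕ (s₁ · r²)` (the circle of radius h = s₁r²∕25 has 5√(h∕s₁) = r;
Mathlib `Complex.norm_deriv_le_of_forall_mem_sphere_norm_le`). [folklore] -/
theorem norm_deriv_le_of_segment (hs₁ : 0 < s₁) (hs₁ρ : s₁ * Real.cosh 1 < ρ) (hε0 : 0 < ε) (hεB : ε ≤ B)
    {r : ℝ} (hr : 0 < r) (hr1 : r ≤ 1) :
    ‖deriv g 0‖ ≤ 25 * (ε ^ (1 - r) * B ^ r) / (s₁ * r ^ 2) := by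
  set h : ℝ := s₁ * r ^ 2 / 25 with hh
  have hh0 : 0 < h := by positivity
  have hh25 : h ≤ s₁ / 25 := by
    rw [hh]; have : r ^ 2 ≤ 1 := by nlinarith
    nlinarith
  have hsq : Real.sqrt (h / s₁) = r / 5 := by
    rw [hh, show s₁ * r ^ 2 / 25 / s₁ = (r / 5) ^ 2 by field_simp; ring]
    exact Real.sqrt_sq (by positivity)
  have hhρ : h < ρ := by
    have h1 : h ≤ s₁ := hh25.trans (by linarith)
    have h2 : s₁ ≤ s₁ * Real.cosh 1 := le_mul_of_one_le_right hs₁.le (Real.one_le_cosh 1)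
    linarith
  have hdc : DiffContOnCl ℂ g (ball (0 : ℂ) h) := hg.diffContOnCl_ball (closedBall_subset_ball hhρ)
  have hC : ∀ z ∈ sphere (0 : ℂ) h, ‖g z‖ ≤ ε ^ (1 - r) * B ^ r := by
    intro z hz
    have := norm_le_of_mem_sphere hg hB hε hs₁ hs₁ρ hε0 hεB hh25 hz
    rwa [hsq, show 5 * (r / 5) = r by ring] at this
  have key := Complex.norm_deriv_le_of_forall_mem_sphere_norm_le hh0 hdc hC
  refine key.trans (le_of_eq ?_)
  rw [hh]
  field_simp

/-- **THE CHOICE OF THE RADIUS — Markov's square**: `‖g′(0)‖ ≤ (25·e²∕(4·s₁)) · ε · max(log(B∕ε), 2)²` (r = 2∕log(B∕ε) when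
log(B∕ε) ≥ 2, where ε^{1−r}B^{r} = ε·e²; else r = 1).  For a degree-n polynomial bounded by 1 on a segment this is the shape of
A. Markov's endpoint bound n² with log(B∕ε) in the role of the degree. [folklore] -/
theorem norm_deriv_le_log_sq (hs₁ : 0 < s₁) (hs₁ρ : s₁ * Real.cosh 1 < ρ) (hε0 : 0 < ε) (hεB : ε ≤ B) :
    ‖deriv g 0‖ ≤ 25 * Real.exp 2 / (4 * s₁) * ε * max (Real.log (B / ε)) 2 ^ 2 := by
  have hB0 : 0 < B := hε0.trans_le hεB
  have hBε : 0 < B / ε := div_pos hB0 hε0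
  set L : ℝ := Real.log (B / ε) with hL
  have hL0 : 0 ≤ L := Real.log_nonneg ((one_le_div hε0).mpr hεB)
  have e1 : ∀ y : ℝ, ε ^ (1 - y) * B ^ y = ε * Real.exp (L * y) := by
    intro y
    rw [Real.rpow_sub hε0, Real.rpow_one, hL, ← Real.rpow_def_of_pos hBε, Real.div_rpow hB0.le hε0.le]
    field_simp
  rcases le_or_gt 2 L with h2 | h2
  · -- r = 2 / L
    have hLpos : 0 < L := by linarith
    have hr : 0 < 2 / L := by positivity
    have hr1 : 2 / L ≤ 1 := (div_le_one hLpos).mpr h2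
    have key := norm_deriv_le_of_segment hg hB hε hs₁ hs₁ρ hε0 hεB hr hr1
    rw [e1, show L * (2 / L) = 2 by field_simp] at key
    refine key.trans (le_of_eq ?_)
    rw [max_eq_left h2]
    field_simp
    ring
  · -- r = 1
    have key := norm_deriv_le_of_segment hg hB hε hs₁ hs₁ρ hε0 hεB one_pos le_rfl
    rw [e1, mul_one, one_pow, mul_one] at key
    have hexp : Real.exp L ≤ Real.exp 2 := Real.exp_le_exp.mpr h2.le
    rw [max_eq_right h2.le]
    calc ‖deriv g 0‖ ≤ 25 * (ε * Real.exp L) / s₁ := key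
      _ ≤ 25 * (ε * Real.exp 2) / s₁ := by gcongr
      _ = 25 * Real.exp 2 / (4 * s₁) * ε * 2 ^ 2 := by field_simp; ring

end TwoConstants

/-- `cosh 1 < 3` (indeed < 2): `2 cosh 1 = e + e⁻¹ < 3 + 1` — so every `s₁ ≤ ρ∕3` has `s₁·cosh 1 < ρ`. [folklore] -/
theorem cosh_one_lt_three : Real.cosh 1 < 3 := by
  have h1 : Real.exp 1 < 3 := Real.exp_one_lt_three
  have h2 : Real.exp (-1) ≤ 1 := Real.exp_le_one_iff.mpr (by norm_num)
  rw [Real.cosh_eq]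
  linarith

end Summit.QuantumFields.BalabanUV.Beta.RemainderExplicitMarkovRate

end
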